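import Summits.AtomisticToContinuum.FouriersLaw.Theses.PhononMeanFreePath
import Summits.AtomisticToContinuum.FouriersLaw.Theorems.PhononMeanFreePathDefs
import Summits.AtomisticToContinuum.FouriersLaw.Theorems.PhononMeanFreePathCoherentDephasingWeakCouplingIntegrability
import Summits.AtomisticToContinuum.FouriersLaw.Theorems.PhononMeanFreePathCoherentDephasingResponseRegularity
import Summits.AtomisticToContinuum.FouriersLaw.Theorems.PhononMeanFreePathCoherentDephasingMeanFieldDuhamel
import Summits.AtomisticToContinuum.FouriersLaw.Theorems.PhononMeanFreePathCoherentDephasingHarmFluxBound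
import Summits.AtomisticToContinuum.FouriersLaw.Theorems.PhononMeanFreePathCoherentDephasingSiteBookkeeping
import Summits.AtomisticToContinuum.FouriersLaw.Theorems.PhononMeanFreePathCoherentDephasingTelescoping
import Summits.AtomisticToContinuum.FouriersLaw.Theorems.PhononMeanFreePathCoherentDephasingLossComposition
import Summits.AtomisticToContinuum.FouriersLaw.Theorems.PhononMeanFreePathCoherentDephasingOfLocalLossBound

/-!
# `CoherentDephasing` from a BULK block loss bound and a CONTACT bound (line `Sketch`, crux stmt-AtomisticToContinuum-11810)

Registered stub `coherentDephasing_of_bulkBlockLoss_of_contactBound` of the lead's skeleton of line `Sketch`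
(coherent-field Beer–Lambert) of the crux `PhononMeanFreePath.CoherentDephasing`: the robust two-hypothesis form of
the landed block reduction `…BlockLoss.coherentDephasing_of_blockLossBound`. For the `(N+1)`-site pinned anharmonic
chain (Langevin baths at sites `0` and `N`) write `E_x = cohEnergy x ≥ 0`, `Ĵ_b = harmFlux b`, `s_x = siteWork x` for
the time-integrated coherent site energies, symmetric harmonic fluxes and site works of the Gibbs-averaged linear
response to a momentum kick at site `0`, and `D_N = γ∫₀^∞ m_N²` for the far-bath dissipation. Hypothesis (i) is the
block loss bound `κ Σ_{i<L₀} E_{x+i} ≤ Σ_{i<L₀} s_{x+i}` only for BULK blocks `x, …, x+L₀-1` with `L ≤ x` and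
`x + L₀ + K ≤ N` (at distance `≥ K+1` from the far bath); hypothesis (ii) is the CONTACT bound
`D_N ≤ (1+C) · max(Ĵ_{N-K-1}, 0)` by the coherent flux into the contact region `{N-K, …, N}`.

Proof. Abstract core `dissipation_le_geometric_bulkBlockLoss` (pure real arithmetic on `ℕ`-indexed families): tile
the bulk sites `a, …, M` (`M = N-K-1`) by `n` blocks of `L₀` sites; the block-boundary fluxes `F_j = Ĵ_{a+jL₀-1}`
are non-increasing (block balance by telescoping + block loss `≥ 0`) and contract by `1/(1+κ)` every two blocks
(transport at a boundary bond, whose two sites lie in the two adjacent blocks), so `Ĵ_M = F_n ≤ max(B,0)·θ^{⌊n/2⌋}`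
(`θ = 1/(1+κ)`, `Ĵ ≤ B` the landed `N`-uniform flux bound) and `D_N ≤ (1+C)·max(B,0)·θ^{⌊n/2⌋}`. The reduction then
concludes `N ∫₀^∞ m_N² → 0` by `N θ^{(N-c)/L'} → 0` (`…Telescoping`) exactly as in `…BlockLoss`, the fixed-`N` site
balances and transport bound coming from `…SiteBookkeeping` (on `…MeanFieldDuhamel`, `…ResponseRegularity`) and the
integrability clause from `pairCorr_sq_integrableOn`.
-/

noncomputable section

open MeasureTheory Set Filter Topology

namespace Summit.AtomisticToContinuum.FouriersLaw.Theorems.CoherentDephasing.BulkContact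

open Literature.MathematicalPhysics.KineticTheory.HeatConduction (pinnedChain PhaseSpace)
open Summit.AtomisticToContinuum.FouriersLaw.Theses.PhononMeanFreePath (CoherentDephasing)
open Summit.AtomisticToContinuum.FouriersLaw.Theorems.PhononMeanFreePath
open Summit.AtomisticToContinuum.FouriersLaw.Theorems.CoherentDephasing.Telescoping (tendsto_natMul_pow_div)
open Summit.AtomisticToContinuum.FouriersLaw.Theorems.CoherentDephasing.MeanFieldDuhamel (stub_meanFieldDuhamel)
open Summit.AtomisticToContinuum.FouriersLaw.Theorems.CoherentDephasing.ResponseRegularity (stub_responseRegularity)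
open Summit.AtomisticToContinuum.FouriersLaw.Theorems.CoherentDephasing.SiteBookkeeping (stub_siteBookkeeping_of_meanField)
open Summit.AtomisticToContinuum.FouriersLaw.Theorems.CoherentDephasing.HarmFluxBound (stub_harmFluxBound)
open Summit.AtomisticToContinuum.FouriersLaw.Theorems.CoherentDephasing.OfLocalLossBound
  (sum_ite_succ_eq sum_ite_val_eq_of_lt sum_ite_val_eq_zero)

/-! ## Abstract part: two-step contraction of the block-boundary fluxes -/

/-- **Iterating a two-step contraction.** If `F : ℕ → ℝ` is non-increasing on `0, …, n`, contracts by `θ ≥ 0` every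
two steps there (`F (j+1) ≤ θ F (j-1)` for `1 ≤ j ≤ n-1`) and `F 0 ≤ B`, then `F n ≤ max(B,0) · θ^{⌊n/2⌋}`. [folklore] -/
theorem le_geometric_of_twoStep (F : ℕ → ℝ) (B θ : ℝ) (n : ℕ) (hθ : 0 ≤ θ)
    (hmono : ∀ j, j < n → F (j + 1) ≤ F j) (hstep : ∀ j, 1 ≤ j → j + 1 ≤ n → F (j + 1) ≤ θ * F (j - 1))
    (hhead : F 0 ≤ B) : F n ≤ max B 0 * θ ^ (n / 2) := by
  -- `F (2k) ≤ θ^k F 0`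
  have hiter : ∀ k, 2 * k ≤ n → F (2 * k) ≤ θ ^ k * F 0 := by
    intro k
    induction k with
    | zero => intro _; simp
    | succ k ih =>
      intro hk
      have h1 := hstep (2 * k + 1) (by omega) (by omega)
      rw [show 2 * k + 1 + 1 = 2 * (k + 1) by ring, Nat.add_sub_cancel] at h1
      calc F (2 * (k + 1)) ≤ θ * F (2 * k) := h1
        _ ≤ θ * (θ ^ k * F 0) := mul_le_mul_of_nonneg_left (ih (by omega)) hθ
        _ = θ ^ (k + 1) * F 0 := by ring
  have hend : F n ≤ θ ^ (n / 2) * F 0 := by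
    obtain ⟨k, hk | hk⟩ := Nat.even_or_odd' n
    · rw [show n / 2 = k by omega, hk]
      exact hiter k (by omega)
    · rw [show n / 2 = k by omega, hk]
      exact (hmono (2 * k) (by omega)).trans (hiter k (by omega))
  calc F n ≤ θ ^ (n / 2) * F 0 := hend
    _ ≤ θ ^ (n / 2) * max B 0 := mul_le_mul_of_nonneg_left (hhead.trans (le_max_left B 0)) (pow_nonneg hθ _)
    _ = max B 0 * θ ^ (n / 2) := mul_comm _ _

/-- **Geometric decay of the coherent flux from a BULK block loss bound and a contact bound** (abstract core).
`J, s, E : ℕ → ℝ` (flux through bond `b`, site work and time-integrated coherent energy at site `x`); the bulk sites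
`a, …, M` (`a ≥ 1`) are tiled by `n` blocks of `L₀ ≥ 1` sites, `a + n L₀ = M + 1`. Assume the site balances
`J (x-1) - J x = s x` on `a ≤ x ≤ M`, the block loss bound `κ Σ_block E ≤ Σ_block s` (`κ > 0`) on each of the `n`
blocks, the transport bound `J b ≤ E b + E (b+1)` for `a ≤ b < M`, `E ≥ 0`, the head bound `J (a-1) ≤ B` and the
contact bound `D ≤ (1+C) max(J M, 0)` (`C ≥ 0`). Then `D ≤ (1+C) · max(B,0) · (1+κ)^{-⌊n/2⌋}`. [folklore] -/
theorem dissipation_le_geometric_bulkBlockLoss (J s E : ℕ → ℝ) (D B κ C : ℝ) (M a L₀ n : ℕ) (hκ : 0 < κ)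
    (hC : 0 ≤ C) (hL₀ : 0 < L₀) (ha : 1 ≤ a) (htile : a + n * L₀ = M + 1)
    (hbal : ∀ x, a ≤ x → x ≤ M → J (x - 1) - J x = s x)
    (hloss : ∀ j, j < n →
      κ * ∑ i ∈ Finset.range L₀, E (a + j * L₀ + i) ≤ ∑ i ∈ Finset.range L₀, s (a + j * L₀ + i))
    (htr : ∀ b, a ≤ b → b < M → J b ≤ E b + E (b + 1)) (hE : ∀ x, 0 ≤ E x) (hhead : J (a - 1) ≤ B)
    (hD : D ≤ (1 + C) * max (J M) 0) :
    D ≤ (1 + C) * max B 0 * (1 / (1 + κ)) ^ (n / 2) := by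
  set θ : ℝ := 1 / (1 + κ) with hθdef
  have hθ0 : 0 ≤ θ := by positivity
  -- products `j * L₀`: the facts `omega` needs, stated on the atoms it sees
  have hmulS : ∀ j : ℕ, (j + 1) * L₀ = j * L₀ + L₀ := fun j => Nat.succ_mul j L₀
  have hmuln : ∀ j : ℕ, j ≤ n → j * L₀ ≤ n * L₀ := fun j hj => Nat.mul_le_mul_right L₀ hj
  have hmul1 : ∀ j : ℕ, 1 ≤ j → L₀ ≤ j * L₀ := fun j hj => Nat.le_mul_of_pos_left L₀ hj
  -- block balance by telescoping the site balances over block `j` (sites `a + jL₀, …, a + jL₀ + L₀ - 1`)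
  have hblock : ∀ j, j < n →
      J (a + j * L₀ - 1) - J (a + (j + 1) * L₀ - 1) = ∑ i ∈ Finset.range L₀, s (a + j * L₀ + i) := by
    intro j hjn
    have hj1 := hmuln (j + 1) hjn
    rw [hmulS] at hj1
    have htel : ∑ i ∈ Finset.range L₀, s (a + j * L₀ + i) =
        ∑ i ∈ Finset.range L₀, (J (a + j * L₀ - 1 + i) - J (a + j * L₀ - 1 + (i + 1))) := by
      refine Finset.sum_congr rfl fun i hi => ?_
      rw [Finset.mem_range] at hi
      rw [← hbal (a + j * L₀ + i) (by omega) (by omega),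
        show a + j * L₀ + i - 1 = a + j * L₀ - 1 + i by omega,
        show a + j * L₀ - 1 + (i + 1) = a + j * L₀ + i by omega]
    rw [htel, Finset.sum_range_sub' (fun i => J (a + j * L₀ - 1 + i)) L₀]
    simp only [add_zero]
    rw [hmulS, show a + (j * L₀ + L₀) - 1 = a + j * L₀ - 1 + L₀ by omega]
  -- the boundary fluxes are non-increasing
  have hmono : ∀ j, j < n → J (a + (j + 1) * L₀ - 1) ≤ J (a + j * L₀ - 1) := by
    intro j hjn
    have h1 := hblock j hjn
    have h2 := hloss j hjn
    have h3 : 0 ≤ κ * ∑ i ∈ Finset.range L₀, E (a + j * L₀ + i) :=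
      mul_nonneg hκ.le (Finset.sum_nonneg fun i _ => hE _)
    linarith
  -- two-step contraction across the interior block boundary `b = a + jL₀ - 1` (sites `b`, `b+1` in blocks `j-1`, `j`)
  have hstep : ∀ j, 1 ≤ j → j + 1 ≤ n →
      J (a + (j + 1) * L₀ - 1) ≤ θ * J (a + (j - 1) * L₀ - 1) := by
    intro j hj1 hjn
    have hjL := hmul1 j hj1
    have hj1' := hmuln (j + 1) hjn
    rw [hmulS] at hj1'
    have hprev : j - 1 + 1 = j := by omega
    have hc := hmulS (j - 1)
    rw [hprev] at hc
    have hb1 := hblock (j - 1) (by omega)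
    rw [hprev] at hb1
    have hb2 := hblock j (by omega)
    have hl1 := hloss (j - 1) (by omega)
    have hl2 := hloss j (by omega)
    have ht := htr (a + j * L₀ - 1) (by omega) (by omega)
    have he1 : E (a + j * L₀ - 1) ≤ ∑ i ∈ Finset.range L₀, E (a + (j - 1) * L₀ + i) := by
      have hmem : L₀ - 1 ∈ Finset.range L₀ := Finset.mem_range.2 (by omega)
      have := Finset.single_le_sum (f := fun i => E (a + (j - 1) * L₀ + i)) (fun i _ => hE _) hmem
      rwa [show a + (j - 1) * L₀ + (L₀ - 1) = a + j * L₀ - 1 by omega] at this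
    have he2 : E (a + j * L₀ - 1 + 1) ≤ ∑ i ∈ Finset.range L₀, E (a + j * L₀ + i) := by
      have hmem : 0 ∈ Finset.range L₀ := Finset.mem_range.2 hL₀
      have := Finset.single_le_sum (f := fun i => E (a + j * L₀ + i)) (fun i _ => hE _) hmem
      rwa [show a + j * L₀ + 0 = a + j * L₀ - 1 + 1 by omega] at this
    have hm := hmono j (by omega)
    have h1 := mul_le_mul_of_nonneg_left hm hκ.le
    have h2 := mul_le_mul_of_nonneg_left ht hκ.le
    have h3 := mul_le_mul_of_nonneg_left (add_le_add he1 he2) hκ.le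
    have hkey : J (a + (j + 1) * L₀ - 1) * (1 + κ) ≤ J (a + (j - 1) * L₀ - 1) := by linarith
    rw [hθdef, one_div_mul_eq_div, le_div_iff₀ (by positivity)]
    exact hkey
  -- geometric decay of the boundary fluxes down to the last bulk bond `M = a + nL₀ - 1`
  have hend : J M ≤ max B 0 * θ ^ (n / 2) := by
    have h := le_geometric_of_twoStep (fun j => J (a + j * L₀ - 1)) B θ n hθ0
      (fun j hj => hmono j hj) (fun j hj1 hjn => hstep j hj1 hjn) (by simpa using hhead)
    have e : a + n * L₀ - 1 = M := by omega
    simpa only [e] using h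
  have hmax : max (J M) 0 ≤ max B 0 * θ ^ (n / 2) :=
    max_le hend (mul_nonneg (le_max_right B 0) (pow_nonneg hθ0 _))
  calc D ≤ (1 + C) * max (J M) 0 := hD
    _ ≤ (1 + C) * (max B 0 * θ ^ (n / 2)) := mul_le_mul_of_nonneg_left hmax (by linarith)
    _ = (1 + C) * max B 0 * θ ^ (n / 2) := by ring

/-! ## The conditional reduction (bulk block loss + contact bound) -/

/-- **`CoherentDephasing` from a bulk block loss bound and a contact bound.** If for every admissible parameter point
there are a block length `L₀ ≥ 1`, a head margin `L`, a contact depth `K`, a threshold `N₀`, a rate `κ > 0` and a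
constant `C ≥ 0` such that for every chain with `N ≥ N₀` (i) every BULK block of `L₀` consecutive sites
`x, …, x+L₀-1` with `L ≤ x` and `x + L₀ + K ≤ N` loses at least `κ ×` its time-integrated coherent energy to the site
works, and (ii) the far-bath dissipation `γ∫₀^∞ m_N²` is at most `(1+C) ×` the positive part of the coherent flux
`Ĵ_{N-K-1}` into the contact region, then the coherent channel closes (`CoherentDephasing`, by name). [folklore] -/
theorem coherentDephasing_of_bulkBlockLoss_of_contactBound :
    (∀ ω₂ lam β γ : ℝ, 0 < ω₂ → 0 < lam → 0 < β → 0 < γ → ∀ T : ℝ, 0 < T →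
      ∃ L₀ L K N₀ : ℕ, ∃ κ C : ℝ, 0 < L₀ ∧ 0 < κ ∧ 0 ≤ C ∧
        (∀ N : ℕ, N₀ ≤ N → ∀ (x : ℕ) (hx : x + L₀ + K ≤ N), L ≤ x →
          κ * ∑ i : Fin L₀, cohEnergy ω₂ lam β γ T N ⟨x + i, by omega⟩ ≤
            ∑ i : Fin L₀, siteWork ω₂ lam β γ T N ⟨x + i, by omega⟩) ∧
        (∀ (N : ℕ) (hN : K < N), N₀ ≤ N →
          γ * ∫ t in Set.Ioi (0 : ℝ), momResp ω₂ lam β γ T N (Fin.last N) t ^ 2 ≤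
            (1 + C) * max (harmFlux ω₂ lam β γ T N ⟨N - K - 1, by omega⟩) 0)) →
    Summit.AtomisticToContinuum.FouriersLaw.Theses.PhononMeanFreePath.CoherentDephasing := by
  intro hH ω₂ lam β γ hω hl hβ hγ T hT
  refine ⟨fun N => Summit.AtomisticToContinuum.FouriersLaw.Theorems.CoherentDephasing.pairCorr_sq_integrableOn
    hω hl.le hβ hγ hT N, ?_⟩
  obtain ⟨B, hBflux⟩ := stub_harmFluxBound ω₂ lam β γ hω hl hβ hγ T hT
  obtain ⟨L₀, L, K, N₀, κ, C, hL₀, hκ, hC, hloss, hcontact⟩ := hH ω₂ lam β γ hω hl hβ hγ T hT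
  have hbook := fun N => stub_siteBookkeeping_of_meanField ω₂ lam β γ hω hl hβ hγ T hT N
    (stub_meanFieldDuhamel ω₂ lam β γ hω hl hβ hγ T hT N) (stub_responseRegularity ω₂ lam β γ hω hl hβ hγ T hT N)
  set D : ℕ → ℝ := fun N => γ * ∫ t in Ioi (0 : ℝ), momResp ω₂ lam β γ T N (Fin.last N) t ^ 2 with hD
  set θ : ℝ := 1 / (1 + κ) with hθ
  have hθ0 : 0 ≤ θ := by positivity
  have hθ1 : θ < 1 := by rw [hθ, div_lt_one (by positivity)]; linarith
  -- head margin `L' = max L 1` (bulk blocks avoid site `0` as well)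
  set L' : ℕ := max L 1 with hL'
  have hL'L : L ≤ L' := le_max_left L 1
  have hL'1 : 1 ≤ L' := le_max_right L 1
  have hI0 : ∀ N : ℕ, 0 ≤ ∫ t in Ioi (0 : ℝ), momResp ω₂ lam β γ T N (Fin.last N) t ^ 2 := fun N =>
    setIntegral_nonneg measurableSet_Ioi fun t _ => sq_nonneg _
  have hgeo : ∀ N : ℕ, N₀ ≤ N → K + L' ≤ N → D N ≤ (1 + C) * max B 0 * θ ^ ((N - K - L') / L₀ / 2) := by
    intro N hN0 hN
    obtain ⟨hbal, htr⟩ := hbook N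
    -- `n` blocks of `L₀` sites ending at the last bulk site `M = N - K - 1`, origin `a = N - K - nL₀ ≥ L'`
    set n : ℕ := (N - K - L') / L₀ with hn
    have hnL : n * L₀ ≤ N - K - L' := Nat.div_mul_le_self _ _
    -- `ℕ`-indexed flux `J`, site work `s` and site energy `E`, junk `0` out of range
    refine dissipation_le_geometric_bulkBlockLoss
      (fun b => if h : b < N then harmFlux ω₂ lam β γ T N ⟨b, h⟩ else 0)
      (fun x => if h : x < N + 1 then siteWork ω₂ lam β γ T N ⟨x, h⟩ else 0)
      (fun x => if h : x < N + 1 then cohEnergy ω₂ lam β γ T N ⟨x, h⟩ else 0)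
      (D N) B κ C (N - K - 1) (N - K - n * L₀) L₀ n hκ hC hL₀ (by omega) (by omega) ?_ ?_ ?_ ?_ ?_ ?_
    · -- site balances at the interior sites `a ≤ x ≤ M` (`1 ≤ x ≤ N - 1`: no bath terms)
      intro x hx1 hx2
      have h := hbal ⟨x, by omega⟩
      rw [sum_ite_succ_eq N _ (show ((⟨x, by omega⟩ : Fin (N + 1)) : ℕ) - 1 < N by simp only; omega)
        (show ((⟨x, by omega⟩ : Fin (N + 1)) : ℕ) ≠ 0 by simp only; omega),
        sum_ite_val_eq_of_lt N _ (show ((⟨x, by omega⟩ : Fin (N + 1)) : ℕ) < N by simp only; omega)] at h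
      simp only at h
      rw [if_neg (by omega), if_neg (by omega), if_neg (by omega)] at h
      rw [dif_pos (show x - 1 < N by omega), dif_pos (show x < N by omega), dif_pos (show x < N + 1 by omega)]
      simp only [add_zero, mul_zero, zero_mul] at h
      linarith
    · -- the bulk block loss bound (hypothesis (i)) at block start `x = a + jL₀`, as `range`-sums
      intro j hjn
      have hj1 : (j + 1) * L₀ ≤ n * L₀ := Nat.mul_le_mul_right L₀ hjn
      rw [Nat.succ_mul] at hj1
      have h := hloss N hN0 (N - K - n * L₀ + j * L₀) (by omega) (by omega)
      have e1 : ∑ i : Fin L₀, cohEnergy ω₂ lam β γ T N ⟨N - K - n * L₀ + j * L₀ + i, by omega⟩ =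
          ∑ i : Fin L₀, (fun y => if h : y < N + 1 then cohEnergy ω₂ lam β γ T N ⟨y, h⟩ else 0)
            (N - K - n * L₀ + j * L₀ + i) := by
        refine Finset.sum_congr rfl fun i _ => ?_
        simp only
        rw [dif_pos (show N - K - n * L₀ + j * L₀ + (i : ℕ) < N + 1 by omega)]
      have e2 : ∑ i : Fin L₀, siteWork ω₂ lam β γ T N ⟨N - K - n * L₀ + j * L₀ + i, by omega⟩ =
          ∑ i : Fin L₀, (fun y => if h : y < N + 1 then siteWork ω₂ lam β γ T N ⟨y, h⟩ else 0)
            (N - K - n * L₀ + j * L₀ + i) := by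
        refine Finset.sum_congr rfl fun i _ => ?_
        simp only
        rw [dif_pos (show N - K - n * L₀ + j * L₀ + (i : ℕ) < N + 1 by omega)]
      rw [e1, e2] at h
      rw [Finset.sum_range, Finset.sum_range]
      exact h
    · -- transport
      intro b hb1 hb2
      rw [dif_pos (show b < N by omega), dif_pos (show b < N + 1 by omega), dif_pos (show b + 1 < N + 1 by omega)]
      exact htr ⟨b, by omega⟩
    · -- `E ≥ 0`
      intro x
      split_ifs
      · exact cohEnergy_nonneg ω₂ lam β γ T N hω.le _
      · exact le_rfl
    · -- head: the `N`-uniform flux bound at bond `a - 1`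
      rw [dif_pos (show N - K - n * L₀ - 1 < N by omega)]
      exact hBflux N _
    · -- contact bound (hypothesis (ii)) at the last bulk bond `M = N - K - 1`
      rw [dif_pos (show N - K - 1 < N by omega)]
      exact hcontact N (by omega) hN0
  -- the exponent `(N - K - L')/L₀/2 = (N - (K + L'))/(L₀ · 2)`
  have hexp : ∀ N : ℕ, (N - K - L') / L₀ / 2 = (N - (K + L')) / (L₀ * 2) := by
    intro N
    rw [Nat.sub_sub, Nat.div_div_eq_div_mul]
  -- squeeze `0 ≤ N ∫ m_N² ≤ (N/γ)(1+C) max(B,0) θ^{…} → 0`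
  have hlim := (tendsto_natMul_pow_div θ hθ0 hθ1 (L₀ * 2) (by positivity) (K + L')).const_mul
    ((1 + C) * max B 0 / γ)
  rw [mul_zero] at hlim
  change Tendsto (fun N : ℕ => (N : ℝ) * ∫ t in Ioi (0 : ℝ), momResp ω₂ lam β γ T N (Fin.last N) t ^ 2) atTop (𝓝 0)
  refine squeeze_zero' (Eventually.of_forall fun N => mul_nonneg (Nat.cast_nonneg N) (hI0 N)) ?_ hlim
  filter_upwards [eventually_ge_atTop (max N₀ (K + L'))] with N hN
  have hN0 : N₀ ≤ N := le_of_max_le_left hN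
  have hN1 : K + L' ≤ N := le_of_max_le_right hN
  have h1 : (N : ℝ) * ∫ t in Ioi (0 : ℝ), momResp ω₂ lam β γ T N (Fin.last N) t ^ 2 = (N : ℝ) * (D N / γ) := by
    simp only [hD]; field_simp
  rw [h1]
  have h2 : D N / γ ≤ (1 + C) * max B 0 / γ * θ ^ ((N - (K + L')) / (L₀ * 2)) := by
    have := div_le_div_of_nonneg_right (hgeo N hN0 hN1) hγ.le
    rw [hexp N] at this
    calc D N / γ ≤ (1 + C) * max B 0 * θ ^ ((N - (K + L')) / (L₀ * 2)) / γ := this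
      _ = (1 + C) * max B 0 / γ * θ ^ ((N - (K + L')) / (L₀ * 2)) := by ring
  calc (N : ℝ) * (D N / γ) ≤ (N : ℝ) * ((1 + C) * max B 0 / γ * θ ^ ((N - (K + L')) / (L₀ * 2))) :=
      mul_le_mul_of_nonneg_left h2 (Nat.cast_nonneg N)
    _ = (1 + C) * max B 0 / γ * ((N : ℝ) * θ ^ ((N - (K + L')) / (L₀ * 2))) := by ring

end Summit.AtomisticToContinuum.FouriersLaw.Theorems.CoherentDephasing.BulkContact

end
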